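import Mathlib
import Literature.Computability.AlgebraicComplexity.ElusiveSymbolic
import Summits.ValiantsHypothesis.ValiantsHypothesis.Statement
import Summits.ValiantsHypothesis.ValiantsHypothesis.Theorems.SoloInformedQuadSpanWindow
import HarnessLib

/-!
# The multivariate (symbolic) window form: `n`-variate sections, order-independent set families,
no heights — and it still implies `VP ℂ ≠ VNP ℂ`
(solo seat `solo-ValiantsHypothesis-informed`, s29)

`SoloInformedQuadSpanWindow` certifies: IF for all large `s` every exponent set `E ⊂ ℕ` that is
free to order `Kf s` (`2 ≤ Kf s ≤ (⌊log₂ s⌋ + 2)^C`) and height `hf s` and realised in the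
quadratic span of `s` UNIVARIATE algebraic functions `b_j ∈ \overline{ℂ(z)}` has `≤ C' s^γ`
elements, `γ < 3/2`, THEN `VP ℂ ≠ VNP ℂ`.  That reduction restricts the design map
`x ↦ (x^{S_i})_i` to the curve `x_r = z^{D^r}` BEFORE taking algebraic sections, so its hypothesis
must control every free set of integers, and the height `h` (hence the base `D = hK + 1`) is part
of the statement.

This file removes the curve.  Garg–Makam–Oliveira–Wigderson's Lemma 9.3 (tree theorem
`exists_aeval_eq_of_not_isElusive`, any number of variables) turns non-elusiveness of the design
map itself into `n`-VARIATE algebraic sections `b_1, …, b_s ∈ \overline{ℂ(x_1, …, x_n)}` with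
every monomial `x^{S_i} = ∏_{r ∈ S_i} x_r` in their quadratic span.  Consequently the summit
follows from the weaker-looking hypothesis

  (Q*-mult)  for all large `s`: whenever a set family `S_1, …, S_m ⊂ Fin n` whose indicator
  vectors admit no nontrivial integer relation with at most `Kf s` terms (ANY height — e.g. every
  `Kf s` of them linearly independent over `ℚ`) is realised in the quadratic span of `s`
  `n`-variate algebraic functions, `m ≤ C' · s^γ` (`γ < 3/2` real),

for any order function `Kf s ≤ (⌊log₂ s⌋ + 2)^C` (`soloInformed_valiantsHypothesis_of_multWindowBound`;
instances `…_of_multLogOrderBound` with `Kf s = ⌊log₂ s⌋ + 2`, `…_of_multFixedOrderBound`).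
Heights have disappeared (there is no base `D`), and only set families — exponent vectors in
`{0,1}^n` — occur, never arbitrary integers.  Informally (Q*-mult) is implied by the univariate
window hypothesis taken at all heights (restrict `n`-variate sections to the curve `x_r = z^{D^r}`
for `D` large, along which they are integral for all but finitely many `D`), and it exposes
structure the univariate form hides: `n` commuting monomial valuations / every weight vector
`c ∈ ℝ^n` gives a place at which the seat's honest-target girth bound holds, the targets are
multilinear, and monomials with linearly independent exponent vectors are algebraically
independent (so parameter-count rigidity needs no heights).  Nothing of (Q*-mult) is proved here
beyond what the univariate notes already give; only the implication is claimed, and its hypothesis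
is OPEN (seat notes `paper/quadspan.md` §2.10, `paper/sharpest.md` §9.8).

Designs, parameters and the Def. 1.3 witness are the explicit Reed–Muller ones of
`SoloInformedWindowDesign` (their sign-independence holds at every height: odd witnesses).
References: R. Raz, Elusive functions and lower bounds for arithmetic circuits, Theory of
Computing 6 (2010), Cor. 5.8 (= Cor. 1.14), Defs. 1.1, 1.3 [Raz2010]; A. Garg, V. Makam,
R. Oliveira, A. Wigderson, More barriers for rank methods, via a "numeric to symbolic" transfer,
FOCS 2019 (arXiv:1904.04299), Lemma 9.3, Prop. 3.3 [GargMakamOliveiraWigderson2019].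
-/

noncomputable section

open MvPolynomial Finset

namespace Summit.ValiantsHypothesis.ValiantsHypothesis.Theorems

open Literature.Computability.AlgebraicComplexity

/-! ### `n`-variate sections, order-`K` independence, realisation of a set family -/

/-- `\overline{ℂ(x_1, …, x_n)}`: the algebraic closure of the rational function field in `n`
variables — the home of `n`-variate algebraic functions. -/
abbrev SoloΩn (n : ℕ) : Type := AlgebraicClosure (FractionRing (MvPolynomial (Fin n) ℂ))

/-- A set family `S : Fin m → Finset (Fin n)` is INDEPENDENT TO ORDER `K`: there is no nontrivial
integer relation `∑ᵢ cᵢ · 1_{Sᵢ} = 0` (coordinatewise) with at most `K` nonzero coefficients, of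
any height.  Equivalently, every `K` of the indicator vectors are linearly independent over `ℚ`. -/
def SoloIndep (K : ℕ) {m n : ℕ} (S : Fin m → Finset (Fin n)) : Prop :=
  ∀ c : Fin m → ℤ, (univ.filter fun i => c i ≠ 0).card ≤ K →
    (∀ r : Fin n, (∑ i, if r ∈ S i then c i else 0) = 0) → ∀ i, c i = 0

/-- The family `S` is REALISED in the quadratic span of the `n`-variate algebraic functions
`b_1, …, b_s ∈ \overline{ℂ(x_1, …, x_n)}`: every monomial `x^{S_i} = ∏_{r ∈ S_i} x_r`
(`soloDesignMap S i`) is a polynomial of total degree `≤ 2` in the `b_j`. -/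
def SoloRealisedFamily {s m n : ℕ} (b : Fin s → SoloΩn n) (S : Fin m → Finset (Fin n)) : Prop :=
  ∀ i, ∃ Γ : MvPolynomial (Fin s) ℂ, Γ.totalDegree ≤ 2 ∧
    aeval b Γ = algebraMap (MvPolynomial (Fin n) ℂ) (SoloΩn n) (soloDesignMap S i)

/-- Independence to order `K` (all heights) gives a `(K, h)`-design for every height `h`. -/
def SoloIndep.toDesign {K m n : ℕ} (h : ℕ) {S : Fin m → Finset (Fin n)} (hS : SoloIndep K S) :
    SoloDesign K h m n :=
  ⟨S, fun c hc _ hsum => hS c hc hsum⟩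

/-- Independence is antitone in the order. -/
theorem SoloIndep.mono {K K' m n : ℕ} {S : Fin m → Finset (Fin n)} (hS : SoloIndep K' S)
    (hK : K ≤ K') : SoloIndep K S :=
  fun c hc hsum => hS c (hc.trans hK) hsum

/-- **Odd witnesses give independence to order `K` at every height** (the 2-adic descent of
`SoloDesign.ofOddWitness`, run at the height of the given relation). -/
theorem soloIndep_ofOddWitness {K m n : ℕ} (S : Fin m → Finset (Fin n))
    (hS : ∀ Y : Finset (Fin m), Y.Nonempty → Y.card ≤ K →
      ∃ t : Fin n, Odd (Y.filter fun i => t ∈ S i).card) :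
    SoloIndep K S := by
  classical
  intro c hc hsum
  have hD := (SoloDesign.ofOddWitness (K := K) (h := univ.sup fun i => (c i).natAbs) S hS).indep
  refine hD c hc (fun i => ?_) hsum
  rw [Int.abs_eq_natAbs]
  have := Finset.le_sup (f := fun i => (c i).natAbs) (Finset.mem_univ i)
  exact_mod_cast this

section QW

variable (a b c : ℕ) (Kf : ℕ → ℕ)

/-- The window design family of `SoloInformedWindowDesign` is independent to order `Kf (s n)` at
every height (its family of sets does not depend on the height parameter). -/
theorem qwDesign_soloIndep (hf : ℕ → ℕ) (n : ℕ) :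
    SoloIndep (Kf (qwS a b c n)) (qwDesign a b c Kf hf n).S :=
  soloIndep_ofOddWitness _ (qwPattern_oddWitness a b c Kf n)

end QW

/-! ### Symbolic elusiveness step, without the curve -/

/-- **Elusiveness from non-realisability (GMOW 2019, Lemma 9.3, `n` variables).**  If no `s`
algebraic functions of `x_1, …, x_n` realise the family `S` in their quadratic span, the monomial
map `x ↦ (x^{S_i})_i` is `(s, 2)`-elusive over `ℂ` (Raz 2010, Def. 1.1).
[cite: GargMakamOliveiraWigderson2019, Lemma 9.3; Raz2010, Def. 1.1] -/
theorem soloInformed_isElusive_of_not_realisedFamily {m n s : ℕ} (S : Fin m → Finset (Fin n))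
    (hQ : ∀ b : Fin s → SoloΩn n, ¬ SoloRealisedFamily b S) :
    IsElusive (soloDesignMap S) s 2 := by
  by_contra hne
  obtain ⟨Γ, b, hΓ, hb⟩ := exists_aeval_eq_of_not_isElusive hne
  exact hQ b fun i => ⟨Γ i, hΓ i, (hb i).symm⟩

/-- **The multivariate reduction, pointwise form.**  Set families
`S n : Fin C(n + r n - 1, r n) → Finset (Fin n)`, Raz's side conditions on `r, s`, the statement
"no `s n` algebraic functions of `n` variables realise `S n` quadratically" eventually, and Def. 1.3
definability of the monomial maps give `VP ℂ ≠ VNP ℂ` (Raz 2010, Cor. 5.8, tree theorem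
`Raz2010_cor_5_8_holds`).  No independence of the family is needed at this point.
[cite: Raz2010, Cor. 5.8 = Cor. 1.14] -/
theorem soloInformed_vp_ne_vnp_of_multWindow_pointwise {r s : ℕ → ℕ}
    (S : ∀ n, Fin (Nat.choose (n + r n - 1) (r n)) → Finset (Fin n))
    (hpar : ∃ n₀ : ℕ, ∀ n ≥ n₀, 3 ≤ r n ∧ r n ≤ n ∧ n ≤ s n)
    (hgrow : ∀ c : ℕ, ∃ n₀ : ℕ, ∀ n ≥ n₀,
      n ^ c * Nat.choose (n + 2 * r n / 3 - 1) (2 * r n / 3) ≤ s n)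
    (hQm : ∃ n₀ : ℕ, ∀ n ≥ n₀, ∀ b : Fin (s n) → SoloΩn n, ¬ SoloRealisedFamily b (S n))
    (hdef : IsPolyDefinableMap (m := fun n => Nat.choose (n + r n - 1) (r n))
      (σ := fun n => Fin n) fun n => soloDesignMap (S n)) :
    VP ℂ ≠ VNP ℂ := by
  refine perNotPComputableComplex_iff_holds.mp ?_
  have hel : ∃ n₀ : ℕ, ∀ n ≥ n₀, ∃ (G : Type) (_ : Field G) (_ : Algebra ℂ G),
      IsElusive (fun i => MvPolynomial.map (algebraMap ℂ G) (soloDesignMap (S n) i))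
        (s n) 2 := by
    obtain ⟨n₀, h0⟩ := hQm
    refine ⟨n₀, fun n hn => ⟨ℂ, inferInstance, inferInstance, ?_⟩⟩
    have hid : (fun i => MvPolynomial.map (algebraMap ℂ ℂ) (soloDesignMap (S n) i))
        = soloDesignMap (S n) := by
      funext i
      rw [Algebra.algebraMap_self, MvPolynomial.map_id]
    rw [hid]
    exact soloInformed_isElusive_of_not_realisedFamily (S n) (h0 n hn)
  exact Raz2010_cor_5_8_holds ℂ ringChar_complex_ne_two r s (fun n => soloDesignMap (S n))
    hpar hgrow hdef hel

/-! ### (Q*-mult) implies the summit -/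

/-- **Multivariate window form, exponent version.**  Let `Kf : ℕ → ℕ` with
`Kf s ≤ (⌊log₂ s⌋ + 2)^C` for `s ≥ s₁`.  If for all `s ≥ s₀`, every set family `S` of `m` subsets
of `Fin n` (any `n`, `m`) that is independent to order `Kf s` and realised in the quadratic span of
`s` algebraic functions of `n` variables satisfies `m^b ≤ c · s^a`, where `2a < 3b`, then
`VP ℂ ≠ VNP ℂ`.  Designs and parameters: the Reed–Muller window designs of
`SoloInformedWindowDesign`. [cite: Raz2010, Cor. 5.8 = Cor. 1.14, Defs. 1.1, 1.3] -/
theorem soloInformed_vp_ne_vnp_of_multWindowBound_exponent (Kf : ℕ → ℕ)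
    {Cexp s₁ : ℕ} (hKf : ∀ s, s₁ ≤ s → Kf s ≤ (Nat.log 2 s + 2) ^ Cexp)
    {a b c s₀ : ℕ} (hab : 2 * a < 3 * b)
    (hQ : ∀ s : ℕ, s₀ ≤ s → ∀ (n m : ℕ) (S : Fin m → Finset (Fin n)), SoloIndep (Kf s) S →
      ∀ g : Fin s → SoloΩn n, SoloRealisedFamily g S → m ^ b ≤ c * s ^ a) :
    VP ℂ ≠ VNP ℂ := by
  obtain ⟨n₀, hn₀⟩ := qw_eventually a b c Kf hKf
  refine soloInformed_vp_ne_vnp_of_multWindow_pointwise (r := qwR a b c Kf) (s := qwS a b c)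
    (fun n => (qwDesign a b c Kf (fun _ => 1) n).S) ?_ ?_ ?_
    (qw_isPolyDefinableMap a b c Kf fun _ => 1)
  · refine ⟨n₀, fun n hn => ?_⟩ -- Raz's parameter conditions `3 ≤ r ≤ n ≤ s`
    obtain ⟨hn1, hf, hW⟩ := hn₀ n hn
    have hr : qwR a b c Kf n = 3 * qwRho a b c n := if_pos hf
    have hWge := qwW_ge a b c (qwTau a b c n)
    have hρ : qwRho a b c n = a * qwTau a b c n + 1 := rfl
    refine ⟨?_, ?_, ?_⟩
    · rw [hr, hρ]; omega
    · rw [hr, hρ]; exact hWge.2.1.trans (hW.trans (Nat.log_le_self 2 n))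
    · exact Nat.le_self_pow (by rw [hρ]; omega) n
  · intro c₀ -- growth: `n^{c₀} · C(n + 2ρ - 1, 2ρ) ≤ n^{c₀ + 2ρ} ≤ n^{2ρ + τ} = s`
    refine ⟨max n₀ (2 ^ qwW a b c c₀), fun n hn => ?_⟩
    obtain ⟨hn1, hf, -⟩ := hn₀ n ((le_max_left _ _).trans hn)
    have hr : qwR a b c Kf n = 3 * qwRho a b c n := if_pos hf
    have hτ : c₀ ≤ qwTau a b c n :=
      le_qwTau a b c (Nat.le_log_of_pow_le one_lt_two ((le_max_right _ _).trans hn))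
    rw [hr, show 2 * (3 * qwRho a b c n) / 3 = 2 * qwRho a b c n by omega]
    unfold qwS
    calc n ^ c₀ * Nat.choose (n + 2 * qwRho a b c n - 1) (2 * qwRho a b c n)
        ≤ n ^ c₀ * n ^ (2 * qwRho a b c n) :=
          Nat.mul_le_mul_left _ (choose_multiset_le_pow hn1 _)
      _ = n ^ (c₀ + 2 * qwRho a b c n) := (pow_add _ _ _).symm
      _ ≤ n ^ (2 * qwRho a b c n + qwTau a b c n) := Nat.pow_le_pow_right hn1 (by omega)
  · -- the bound beats the arity: the window design at `n` is never realised by `s n` functions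
    refine ⟨max n₀ s₀, fun n hn g hreal => ?_⟩
    obtain ⟨hn1, hf, hW⟩ := hn₀ n ((le_max_left _ _).trans hn)
    have hr : qwR a b c Kf n = 3 * qwRho a b c n := if_pos hf
    have hWge := qwW_ge a b c (qwTau a b c n)
    have hlog : Nat.log 2 n < n := Nat.log_lt_self 2 (by omega)
    have hs₀ : s₀ ≤ qwS a b c n :=
      ((le_max_right _ _).trans hn).trans (Nat.le_self_pow (by unfold qwRho; omega) n)
    have hQ' := hQ _ hs₀ n _ (qwDesign a b c Kf (fun _ => 1) n).S
      (qwDesign_soloIndep a b c Kf (fun _ => 1) n) g hreal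
    rw [hr] at hQ'
    unfold qwS qwRho at hQ'
    set τ := qwTau a b c n with hτdef
    obtain ⟨d₁, hd₁⟩ : ∃ d₁, 3 * b = 2 * a + 1 + d₁ := ⟨3 * b - (2 * a + 1), by omega⟩
    have hident : (2 * (a * τ + 1) + τ) * a + (a * τ * d₁ + d₁ + 1) = 3 * (a * τ + 1) * b := by
      rw [show 3 * (a * τ + 1) * b = (a * τ + 1) * (3 * b) by ring, hd₁]; ring
    have h1 : n ^ (3 * (a * τ + 1)) ≤
        Nat.factorial (3 * (a * τ + 1)) * Nat.choose (n + 3 * (a * τ + 1) - 1) (3 * (a * τ + 1)) :=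
      solo_pow_le_factorial_mul_choose_multiset n _
    have h2 : n ^ (3 * (a * τ + 1) * b) ≤
        Nat.factorial (3 * (a * τ + 1)) ^ b * (c * (n ^ (2 * (a * τ + 1) + τ)) ^ a) :=
      calc n ^ (3 * (a * τ + 1) * b) = (n ^ (3 * (a * τ + 1))) ^ b := pow_mul _ _ _
        _ ≤ (Nat.factorial (3 * (a * τ + 1)) *
              Nat.choose (n + 3 * (a * τ + 1) - 1) (3 * (a * τ + 1))) ^ b :=
            Nat.pow_le_pow_left h1 _
        _ = Nat.factorial (3 * (a * τ + 1)) ^ b *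
              Nat.choose (n + 3 * (a * τ + 1) - 1) (3 * (a * τ + 1)) ^ b := mul_pow _ _ _
        _ ≤ Nat.factorial (3 * (a * τ + 1)) ^ b * (c * (n ^ (2 * (a * τ + 1) + τ)) ^ a) :=
            Nat.mul_le_mul_left _ hQ'
    have h3 : n ^ ((2 * (a * τ + 1) + τ) * a) * n ≤ n ^ (3 * (a * τ + 1) * b) := by
      rw [← hident, pow_add]; exact Nat.mul_le_mul_left _ (Nat.le_self_pow (by omega) n)
    have h4 : n ^ ((2 * (a * τ + 1) + τ) * a) * n ≤
        n ^ ((2 * (a * τ + 1) + τ) * a) * (Nat.factorial (3 * (a * τ + 1)) ^ b * c) :=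
      calc n ^ ((2 * (a * τ + 1) + τ) * a) * n ≤ n ^ (3 * (a * τ + 1) * b) := h3
        _ ≤ Nat.factorial (3 * (a * τ + 1)) ^ b * (c * (n ^ (2 * (a * τ + 1) + τ)) ^ a) := h2
        _ = n ^ ((2 * (a * τ + 1) + τ) * a) * (Nat.factorial (3 * (a * τ + 1)) ^ b * c) := by
            rw [← pow_mul]; ring
    have h5 : n ≤ Nat.factorial (3 * (a * τ + 1)) ^ b * c :=
      Nat.le_of_mul_le_mul_left h4 (by positivity)
    have h6 : c * Nat.factorial (3 * (a * τ + 1)) ^ b < n :=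
      lt_of_le_of_lt (hWge.2.2.2.trans hW) hlog
    linarith [h5, h6]

/-- **Multivariate window form, real-exponent version**: a bound `m ≤ C' · s^γ`, `γ < 3/2` real, for
the set families independent to order `Kf s` (`Kf s ≤ (⌊log₂ s⌋ + 2)^C` eventually) and realised in
the quadratic span of `s` algebraic functions of `n` variables, `s ≥ s₀`, implies `VP ℂ ≠ VNP ℂ`.
[cite: Raz2010, Cor. 5.8 = Cor. 1.14] -/
theorem soloInformed_vp_ne_vnp_of_multWindowBound_rpow (Kf : ℕ → ℕ)
    {Cexp s₁ : ℕ} (hKf : ∀ s, s₁ ≤ s → Kf s ≤ (Nat.log 2 s + 2) ^ Cexp)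
    {γ C : ℝ} (hγ : γ < 3 / 2) {s₀ : ℕ}
    (hQ : ∀ s : ℕ, s₀ ≤ s → ∀ (n m : ℕ) (S : Fin m → Finset (Fin n)), SoloIndep (Kf s) S →
      ∀ g : Fin s → SoloΩn n, SoloRealisedFamily g S → (m : ℝ) ≤ C * (s : ℝ) ^ γ) :
    VP ℂ ≠ VNP ℂ := by
  set γ' := max γ 0 with hγ' -- exponents `a / b` with `γ' ≤ a / b` and `2a < 3b`
  have hγ'0 : 0 ≤ γ' := le_max_right _ _
  have hγ'lt : γ' < 3 / 2 := max_lt hγ (by norm_num)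
  have hpos : 0 < 3 - 2 * γ' := by linarith
  obtain ⟨b, hb⟩ := exists_nat_gt (2 / (3 - 2 * γ'))
  have hb2 : 2 < (b : ℝ) * (3 - 2 * γ') := (div_lt_iff₀ hpos).1 hb
  have hb0r : (0 : ℝ) < b := lt_trans (by positivity) hb
  have hb0 : 0 < b := by exact_mod_cast hb0r
  set a := ⌈γ' * b⌉₊ with ha
  have ha1 : γ' * b ≤ a := Nat.le_ceil _
  have ha2 : (a : ℝ) < γ' * b + 1 := Nat.ceil_lt_add_one (by positivity)
  have hab : 2 * a < 3 * b := by exact_mod_cast (by linarith : (2 * a : ℝ) < 3 * b)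
  set C' := max C 0 with hC'
  have hC'0 : 0 ≤ C' := le_max_right _ _
  refine soloInformed_vp_ne_vnp_of_multWindowBound_exponent Kf hKf (a := a) (b := b)
    (c := ⌈C' ^ b⌉₊) (s₀ := max s₀ 1) hab fun s hs n m S hind g hreal => ?_
  have hs1 : (1 : ℝ) ≤ s := by exact_mod_cast (le_max_right _ _).trans hs
  have hs0 : (0 : ℝ) ≤ s := by positivity
  have hγab : γ ≤ (a : ℝ) / b :=
    calc γ ≤ γ' := le_max_left _ _
      _ ≤ (a : ℝ) / b := by rw [le_div_iff₀ hb0r]; exact ha1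
  have h1 : (m : ℝ) ≤ C' * (s : ℝ) ^ ((a : ℝ) / b) :=
    calc (m : ℝ) ≤ C * (s : ℝ) ^ γ := hQ s ((le_max_left _ _).trans hs) n m S hind g hreal
      _ ≤ C' * (s : ℝ) ^ γ := mul_le_mul_of_nonneg_right (le_max_left _ _) (by positivity)
      _ ≤ C' * (s : ℝ) ^ ((a : ℝ) / b) :=
          mul_le_mul_of_nonneg_left (Real.rpow_le_rpow_of_exponent_le hs1 hγab) hC'0
  have h2 : ((m : ℝ)) ^ b ≤ C' ^ b * (s : ℝ) ^ a :=
    calc ((m : ℝ)) ^ b ≤ (C' * (s : ℝ) ^ ((a : ℝ) / b)) ^ b :=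
          pow_le_pow_left₀ (by positivity) h1 b
      _ = C' ^ b * ((s : ℝ) ^ ((a : ℝ) / b)) ^ b := mul_pow _ _ _
      _ = C' ^ b * (s : ℝ) ^ a := by
          congr 1
          rw [← Real.rpow_natCast ((s : ℝ) ^ ((a : ℝ) / b)) b, ← Real.rpow_mul hs0,
            div_mul_cancel₀ (a : ℝ) hb0r.ne', Real.rpow_natCast]
  have h3 : ((m ^ b : ℕ) : ℝ) ≤ ((⌈C' ^ b⌉₊ * s ^ a : ℕ) : ℝ) := by
    push_cast
    calc ((m : ℝ)) ^ b ≤ C' ^ b * (s : ℝ) ^ a := h2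
      _ ≤ (⌈C' ^ b⌉₊ : ℝ) * (s : ℝ) ^ a :=
          mul_le_mul_of_nonneg_right (Nat.le_ceil _) (by positivity)
  exact_mod_cast h3

/-- **(Q*-mult) ⟹ Valiant's hypothesis** (the summit constant).  Orders
`Kf s ≤ (⌊log₂ s⌋ + 2)^C` (eventually); NO heights: if for all large `s` every set family of `m`
subsets of `Fin n` that is independent to order `Kf s` (no nontrivial `≤ Kf s`-term integer relation
among the indicator vectors) and realised in the quadratic span of `s` algebraic functions of
`x_1, …, x_n` has `m ≤ C' · s^γ`, `γ < 3/2` real, then `ValiantsHypothesis`.  This is the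
implication only; its hypothesis is open. [cite: Raz2010, Cor. 5.8 = Cor. 1.14;
GargMakamOliveiraWigderson2019, Lemma 9.3] -/
theorem soloInformed_valiantsHypothesis_of_multWindowBound (Kf : ℕ → ℕ)
    {Cexp s₁ : ℕ} (hKf : ∀ s, s₁ ≤ s → Kf s ≤ (Nat.log 2 s + 2) ^ Cexp)
    {γ C : ℝ} (hγ : γ < 3 / 2) {s₀ : ℕ}
    (hQ : ∀ s : ℕ, s₀ ≤ s → ∀ (n m : ℕ) (S : Fin m → Finset (Fin n)), SoloIndep (Kf s) S →
      ∀ g : Fin s → SoloΩn n, SoloRealisedFamily g S → (m : ℝ) ≤ C * (s : ℝ) ^ γ) :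
    ValiantsHypothesis :=
  soloInformed_vp_ne_vnp_of_multWindowBound_rpow Kf hKf hγ hQ

/-- **(VB-log-mult) ⟹ Valiant's hypothesis.**  If for some real `γ < 3/2` and some `C`, for all
large `s`, every set family `S_1, …, S_m ⊂ Fin n` whose indicator vectors satisfy no nontrivial
integer relation with at most `⌊log₂ s⌋ + 2` terms, and whose monomials `x^{S_i}` all lie in the
quadratic span of `s` algebraic functions of `x_1, …, x_n`, has `m ≤ C · s^γ`, then `VP ℂ ≠ VNP ℂ`.
(Known examples: monomial sections realise order-`K`-independent families of size
`≍ s^{1 + 1/⌊K/2⌋}`, i.e. `s^{1+o(1)}` at growing order; nothing below `s^{3/2}` is excluded by an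
example and no such bound is proved: the hypothesis is open.)
[cite: Raz2010, Cor. 5.8 = Cor. 1.14; GargMakamOliveiraWigderson2019, Lemma 9.3] -/
theorem soloInformed_valiantsHypothesis_of_multLogOrderBound {γ C : ℝ} (hγ : γ < 3 / 2) {s₀ : ℕ}
    (hQ : ∀ s : ℕ, s₀ ≤ s → ∀ (n m : ℕ) (S : Fin m → Finset (Fin n)),
      SoloIndep (Nat.log 2 s + 2) S → ∀ g : Fin s → SoloΩn n, SoloRealisedFamily g S →
        (m : ℝ) ≤ C * (s : ℝ) ^ γ) :
    ValiantsHypothesis :=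
  soloInformed_valiantsHypothesis_of_multWindowBound (fun s => Nat.log 2 s + 2) (Cexp := 1)
    (s₁ := 0) (fun s _ => by rw [pow_one]) hγ hQ

/-- **Fixed order.**  For any fixed `K`: a bound `C · s^γ`, `γ < 3/2`, on the size of the
order-`K`-independent set families realised in the quadratic span of `s` algebraic functions of
`n` variables (all large `s`, all `n`) implies `VP ℂ ≠ VNP ℂ`.  (For `K ≤ 5` the hypothesis is
FALSE — `C₄`-free graphs on the variables give `≍ s^{3/2}` realised pair-monomials — so this is of
interest for `K ≥ 6` only.) [cite: Raz2010, Cor. 5.8 = Cor. 1.14] -/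
theorem soloInformed_valiantsHypothesis_of_multFixedOrderBound (K : ℕ) {γ C : ℝ} (hγ : γ < 3 / 2)
    {s₀ : ℕ}
    (hQ : ∀ s : ℕ, s₀ ≤ s → ∀ (n m : ℕ) (S : Fin m → Finset (Fin n)), SoloIndep K S →
      ∀ g : Fin s → SoloΩn n, SoloRealisedFamily g S → (m : ℝ) ≤ C * (s : ℝ) ^ γ) :
    ValiantsHypothesis := by
  refine soloInformed_valiantsHypothesis_of_multWindowBound (fun _ => K) (Cexp := K) (s₁ := 0)
    (fun s _ => ?_) hγ hQ
  calc K ≤ 2 ^ K := Nat.lt_two_pow_self.le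
    _ ≤ (Nat.log 2 s + 2) ^ K := Nat.pow_le_pow_left (by omega) K

end Summit.ValiantsHypothesis.ValiantsHypothesis.Theorems

end
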